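import Summits.QuantumFields.BalabanUV.Beta.FP.NestedDressingKernel

/-!
# `BalabanUV.Beta.FP.NestedDressingLinear` — road «FP» for binder row D1, R-FP-45 (B), row NESTED-DRESS, FILE 7: THE NESTED PROJECTOR IS ITS WINDOWED MATRIX —
# `(Π^{(m)}_nest A)_κ′(u′) = Σ_{v ∈ cube (Lc^m)} Σ_κ pmSymNest ρ Lc m κ′ u′ κ (u′ − v) · A_κ(u′ − v)` for EVERY 1-form `A` (finite sum; in-block root), so every
# Form-level letter of FILES 1–3 is a statement about the kernel `piKSymNest` of FILE 4 acting on columns (an2's `coProjSymAt` ∕ `SymmetrisedDressingLinear` pattern)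

HONEST DEPENDENCY (page 1, mandatory): continuum YM on T⁴ ⇐ BetaPertH ∧ nine spine estimates (0/9 proved); BetaPertH ⇐ (D1) ∧ (D4) ∧ CAP+tail;
G-an2-4 gates asym, D1 and NE2/3/4.  HONEST FRAMING (cell contract, verbatim): «discharging `BetaPertH` makes Bałaban's UV stability UNCONDITIONAL —
a real constructive-QFT result; it is NOT the continuum limit and NOT the Clay problem.»  THIS MODULE DISCHARGES NOTHING of the wall: [folklore] finite sums;
ONE plumbing definition (`coProjNestAt`, the windowed matrix action, cf. an2 `coProjSymAt`), no `def … : Prop`, nothing cited, 0 sorry; 0∕4 row-D1 binders;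
NOT SDF, NOT D1, NOT BetaPertH, NOT continuum, NOT Clay.  «not in print; our bookkeeping».

ABSOLUTE RULE (cell charter, verbatim): «No internally-minted statement may enter as a cited fact. Every hypothesis is either kernel-proved in this package or a
verbatim quotation of a PUBLISHED theorem with page reference. The manuscript(s) under audit are NOT citable for their own disputed steps — they are the thing
under adjudication; programme-internal (2001/route/tribunal) claims are never citable.»

CONTENTS ([folklore]; `d+1` dimensions, in-block root `r ∈ box (d+1) Lc`, `1 ≤ Lc`): `symAxProjNestAtLin` (the evaluation `A ↦ (Π^{(m)} A)_κ′(u′)` as an `ℝ`-linear map, from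
FILE 3 `_add ∕ _smul`), `symAxProjNestAt_sum_smul`, [our object] `coProjNestAt` (the Π-side action; an2's `coProjSymAt` is the Πᵀ-side one), `windowRestr_apply`,
**`symAxProjNestAt_eq_coProjNestAt`** (THE IDENTITY).
Provenance: road FP swarm LEAF PROVER `b2b-balaban-beta-d1-formalise-leaf-06` gen 14, 2026-08-21, row NESTED-DRESS.  Names PROVISIONAL.
-/

noncomputable section

open Finset
open scoped BigOperators
open Literature.MathematicalPhysics.QuantumFieldTheory
open Literature.MathematicalPhysics.QuantumFieldTheory.Balaban1983to89
open Literature.MathematicalPhysics.QuantumFieldTheory.Balaban1983to89.Beta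
open AffineAveraging (Form0 Form1 Site unitVec unitVec_apply box toSite)
open AveragingContours (grad blk)
open Summit.QuantumFields.BalabanUV.Beta.AxialDressingRooted (cube mem_cube zero_mem_cube)
open Summit.QuantumFields.BalabanUV.Beta.SymmetrisedDressingMatrix (bondIndR bondIndR_apply sub_mem_cube_of_blk_eq sub_mem_cube_of_blk_eq_succ)
open Summit.QuantumFields.BalabanUV.Beta.CompositeCorrectorLocality (InBlockBond mem_inBlockBond)
open Summit.QuantumFields.BalabanUV.Beta.FP.NestedDressingProjector (symAxProjNestAt)
open Summit.QuantumFields.BalabanUV.Beta.FP.NestedDressingProjectorLocality (symAxProjNestAt_apply_eq_of_forall)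
open Summit.QuantumFields.BalabanUV.Beta.FP.NestedDressingProjectorBounds (symAxProjNestAt_add symAxProjNestAt_smul)
open Summit.QuantumFields.BalabanUV.Beta.FP.NestedDressingKernel (pmSymNest)

namespace Summit.QuantumFields.BalabanUV.Beta.FP.NestedDressingLinear

variable {d : ℕ}

/-- [folklore] The evaluation `A ↦ (Π^{(m)}_nest A)_κ′(u′)` as an `ℝ`-LINEAR MAP (FILE 3's additivity and homogeneity). -/
def symAxProjNestAtLin (ρ : Fin (d + 1) → ℤ) (Lc m : ℕ) (κ' : Fin (d + 1)) (u' : Fin (d + 1) → ℤ) : Form1 (d + 1) ℝ →ₗ[ℝ] ℝ where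
  toFun A := symAxProjNestAt ρ Lc m A κ' u'
  map_add' A B := by rw [symAxProjNestAt_add]; rfl
  map_smul' c A := by rw [symAxProjNestAt_smul]; rfl

/-- [folklore] The linear map evaluates to the projector. -/
theorem symAxProjNestAtLin_apply (ρ : Fin (d + 1) → ℤ) (Lc m : ℕ) (κ' : Fin (d + 1)) (u' : Fin (d + 1) → ℤ) (A : Form1 (d + 1) ℝ) :
    symAxProjNestAtLin ρ Lc m κ' u' A = symAxProjNestAt ρ Lc m A κ' u' := rfl

/-- [folklore] `Π^{(m)}_nest` passes through finite linear combinations. -/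
theorem symAxProjNestAt_sum_smul {ι : Type*} (s : Finset ι) (c : ι → ℝ) (B : ι → Form1 (d + 1) ℝ) (ρ : Fin (d + 1) → ℤ) (Lc m : ℕ)
    (κ' : Fin (d + 1)) (u' : Fin (d + 1) → ℤ) :
    symAxProjNestAt ρ Lc m (∑ i ∈ s, c i • B i) κ' u' = ∑ i ∈ s, c i * symAxProjNestAt ρ Lc m (B i) κ' u' := by
  have h := map_sum (symAxProjNestAtLin ρ Lc m κ' u') (fun i => c i • B i) s
  simp only [symAxProjNestAtLin_apply, map_smul, smul_eq_mul] at h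
  exact h

/-- [our object, plumbing] **THE WINDOWED MATRIX ACTION** `(coProjNestAt ρ Lc m A)_κ′(u′) := Σ_{v ∈ cube (Lc^m)} Σ_κ pmSymNest ρ Lc m κ′ u′ κ (u′ − v) · A_κ(u′ − v)`
(cf. an2's `coProjSymAt`; the window is FILE 4's `window_of_pmSymNest_ne_zero`). -/
def coProjNestAt (ρ : Fin (d + 1) → ℤ) (Lc m : ℕ) (A : Form1 (d + 1) ℝ) : Form1 (d + 1) ℝ :=
  fun κ' u' => ∑ v ∈ cube (d + 1) (Lc ^ m), ∑ κ : Fin (d + 1), pmSymNest ρ Lc m κ' u' κ (u' - v) * A κ (u' - v)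

/-- [folklore] The window restriction of `A` at `u′`: the finite linear combination of bond indicators over the window. -/
theorem windowRestr_apply (Lc m : ℕ) (A : Form1 (d + 1) ℝ) (u' : Fin (d + 1) → ℤ) (κ₀ : Fin (d + 1)) (q₀ : Fin (d + 1) → ℤ) :
    (∑ v ∈ cube (d + 1) (Lc ^ m), ∑ κ : Fin (d + 1), A κ (u' - v) • bondIndR κ (u' - v)) κ₀ q₀
      = if u' - q₀ ∈ cube (d + 1) (Lc ^ m) then A κ₀ q₀ else 0 := by
  simp only [Finset.sum_apply, Pi.smul_apply, smul_eq_mul, bondIndR_apply, mul_ite, mul_one, mul_zero]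
  -- inner sum over κ: only κ = κ₀ survives; outer over v: only v = u' - q₀
  have hinner : ∀ v : Fin (d + 1) → ℤ, (∑ κ : Fin (d + 1), if κ₀ = κ ∧ q₀ = u' - v then A κ (u' - v) else 0)
      = if q₀ = u' - v then A κ₀ q₀ else 0 := by
    intro v
    by_cases hq : q₀ = u' - v
    · rw [if_pos hq]
      rw [Finset.sum_eq_single κ₀]
      · rw [if_pos ⟨rfl, hq⟩, ← hq]
      · intro κ _ hκ; rw [if_neg]; rintro ⟨h, -⟩; exact hκ h.symm
      · intro h; exact absurd (Finset.mem_univ κ₀) h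
    · rw [if_neg hq]
      exact Finset.sum_eq_zero fun κ _ => by rw [if_neg]; rintro ⟨-, h⟩; exact hq h
  simp only [hinner]
  by_cases hw : u' - q₀ ∈ cube (d + 1) (Lc ^ m)
  · rw [if_pos hw, Finset.sum_eq_single (u' - q₀)]
    · rw [if_pos]; abel
    · intro v _ hv; rw [if_neg]; intro h; apply hv; rw [h]; abel
    · intro h; exact absurd hw h
  · rw [if_neg hw]
    exact Finset.sum_eq_zero fun v hv => by
      rw [if_neg]; intro h; apply hw; rw [h]; simpa using hv

/-- [folklore] **THE NESTED PROJECTOR IS ITS WINDOWED MATRIX** (in-block root, `Lc ≥ 1`): `(Π^{(m)}_nest A)_κ′(u′) = (coProjNestAt ρ Lc m A)_κ′(u′)` for every `A`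
— FILE 2's read set at `(κ′, u′)` lies inside the window `{q : u′ − q ∈ cube (Lc^m)}`, on which `A` agrees with its window restriction (a finite combination of bond
indicators), and `Π^{(m)}` is linear. -/
theorem symAxProjNestAt_eq_coProjNestAt {Lc : ℕ} (hLc : 1 ≤ Lc) {r : Fin (d + 1) → ℕ} (hr : r ∈ box (d + 1) Lc) (m : ℕ) (A : Form1 (d + 1) ℝ)
    (κ' : Fin (d + 1)) (u' : Fin (d + 1) → ℤ) :
    symAxProjNestAt (toSite r) Lc m A κ' u' = coProjNestAt (toSite r) Lc m A κ' u' := by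
  have hLm : 1 ≤ Lc ^ m := Nat.one_le_pow _ _ hLc
  set W : Form1 (d + 1) ℝ := ∑ v ∈ cube (d + 1) (Lc ^ m), ∑ κ : Fin (d + 1), A κ (u' - v) • bondIndR κ (u' - v) with hW
  -- `A` and its window restriction agree on the read set
  have hagree : symAxProjNestAt (toSite r) Lc m A κ' u' = symAxProjNestAt (toSite r) Lc m W κ' u' := by
    refine symAxProjNestAt_apply_eq_of_forall hLc hr m κ' u' ?_ ?_ ?_
    · rw [hW, windowRestr_apply, if_pos (by rw [sub_self]; exact zero_mem_cube _)]
    · intro κ₀ q₀ hq _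
      rw [hW, windowRestr_apply, if_pos (sub_mem_cube_of_blk_eq hLm hq)]
    · intro κ₀ q₀ hq _
      rw [hW, windowRestr_apply, if_pos (sub_mem_cube_of_blk_eq_succ hLm hq)]
  rw [hagree, hW]
  -- linearity over the finite window
  rw [show (∑ v ∈ cube (d + 1) (Lc ^ m), ∑ κ : Fin (d + 1), A κ (u' - v) • bondIndR κ (u' - v))
      = ∑ p ∈ cube (d + 1) (Lc ^ m) ×ˢ (Finset.univ : Finset (Fin (d + 1))), A p.2 (u' - p.1) • bondIndR p.2 (u' - p.1) from
      (Finset.sum_product (cube (d + 1) (Lc ^ m)) Finset.univ (fun p => A p.2 (u' - p.1) • bondIndR p.2 (u' - p.1))).symm]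
  rw [symAxProjNestAt_sum_smul, Finset.sum_product]
  simp only [coProjNestAt, pmSymNest]
  refine Finset.sum_congr rfl fun v _ => Finset.sum_congr rfl fun κ _ => ?_
  ring

end Summit.QuantumFields.BalabanUV.Beta.FP.NestedDressingLinear

end
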